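import Summits.BirchSwinnertonDyer.Rank1Residual.Additive.RamifiedSevenGenusFrameArithmeticInputs
import HarnessLib

/-!
# K2C-14 (P4/4) — the ARITHMETIC INPUTS of a `𝒞₇` genus frame (`GenusSeven.GenusFrame`): §B part 2 (`etaOne_isPrimitive`, `g`, `r`, `η₁`) and the assembly check `mkGenusFrame`

Port (pen `bsd-cm` D1059) of the crux workfile `Cruxes/EllipticUnitValueSevenOfGZK/K2C14GenusFrameArithmeticInputs_g77.lean`
(commit e142b9ea3ae9, tree sha16 80281c1844350e71) by seat bsd-idea-20 g77; row K2C-14 (pen D1048).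

Cell bsd-cm, seat bsd-idea-20 g77 (planner, crux-level, W-79 publish-only), crux `EllipticUnitValueSevenOfGZK`
(stmt-BirchSwinnertonDyer-19945, route K7r `RamifiedSevenEllipticUnits`).  Specification = the K2C-11 inventory memo v3
`Cruxes/EllipticUnitValueSevenOfGZK/K2C11ConstructionInventory_g76.md` (tree 12ee9b0d407224ef) §1(b)/(c); row card
`pub/bsd-cm/bsd-cm-plan/g37/SUMMON-typers-K2C-13-16.md` (7e0dfdb9162e356c); pen rulings D1044 (C), D1045, D1048.

SPLIT (pen D1061; the tree's 400-line rule for files with proofs): the port is FOUR files with one namespace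
`Summit.BirchSwinnertonDyer.Rank1Residual.Additive.GenusSeven.ArithmeticInputs` and a linear import chain —
P1 `RamifiedSevenGenusFrameArithmeticKernels.lean` (§A1–A4), P2 `RamifiedSevenGenusFrameGaussSqrt.lean` (§A5),
P3 `RamifiedSevenGenusFrameArithmeticInputs.lean` (§B part 1: `v` … `ω`), P4 `RamifiedSevenGenusFrameArithmeticInputsEta.lean`
(§B part 2: `etaOne_isPrimitive`, `g`, `r`, `η₁`, the assembly check `mkGenusFrame`).  Content = commit e142b9ea3ae9 verbatim up to
the five D1059 edits (namespace, `set_option`, draft sentence) and this split.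

THIS PART (P4) and P3 — §B THE FRAME INPUTS at `(p, level) = (7, |D|)` — field (FactorisationShape line) ↦ declaration here (hypotheses), each
conclusion in the EXACT letter of the field (`D`-hypotheses: `hD : D < 0`, `hD4 : D % 4 = 1`, `hsq : Squarefree D`,
`h7 : ¬ 7 ∣ D`, instance `[NeZero D.natAbs]` (from `hD`); `hKL` the displayed named fact, for `g` only, as the row card says):
  `v`, `seven_mem_v` (l.113–114) ↦ `placeSeven`, `seven_mem_placeSeven` · `F₀`, `F₀_eq`, `F₀_le` (l.116–119) ↦ `F₀ D`,
  `F₀_eq` (rfl), `F₀_le (hD hD4 hsq)` · `ζsys`, `ζsys_compatible` (l.121–122) ↦ `ζsys D`, `ζsys_compatible (h7)` (ONE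
  root system: `Kato2004.primitiveRootUnit ℚ 7 (n+1) · ζ_{|D|}^{(7⁻¹ mod |D|)^{n+1}}`; `ζsys_pow_natAbs` = the sharing with
  `KummerFrame.ζ`) · `u`, `u_topGenerator` (l.124–125) ↦ `u` (`coe_u : u = 64`), `u_topGenerator` · `γ₀`,
  `cyclotomicCharacter_γ₀`, `γ₀_mem` (l.127–129) ↦ `γ₀ = σ₈²` (`cyclotomicCharacter_σ₈ : χ₇ σ₈ = 8`, `σ₈` trivial on
  prime-to-7 roots of unity), `cyclotomicCharacter_γ₀` (rfl), `γ₀_mem (hD hD4 hsq h7)` · `χD`, `χD_isPrimitive`, `χD_mul_self`,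
  `χD_neg_one` (l.131–134) ↦ `χD D = jacobiCharInt |D| ∘ (ℤ → ℤ₇)`, `χD_isPrimitive (hD4 hsq)`, `χD_mul_self`, `χD_neg_one (hD
  hD4)` · `ω`, `ω_teichmuller` (l.136–137) ↦ `ω = MulChar.ofUnitHom (Kato2004.teichmullerChar 7)`, `ω_teichmuller` ·
  `etaOne_isPrimitive` (l.141–142) ↦ `etaOne_isPrimitive (hD4 hsq h7)` (via `isPrimitive_mul_of_coprime_levels`) · `η₁`,
  `η₁_trivial`, `η₁_reading` (l.143–147) ↦ `η₁ D h7` (`= toUnitHom (χ_D ω⁵) ∘ galToPow`, `galToPow` = Mathlib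
  `IsPrimitiveRoot.autToPow` of `ζsys D 0` along `absoluteGaloisGroup.toAlgEquiv`), `η₁_trivial (hD hD4 hsq h7)`, `η₁_reading
  (h7)` · `g`, `g_spec` (l.148–150) ↦ `g D hKL hD4 hsq h7`, `g_spec` · `r`, `r_logTable` (l.153–154) ↦ `r`, `r_logTable`.
  NOT HERE: `D … normA_coprime` (road parameters l.102–111) and `U` (l.156–157, row K2C-13 ★).
  ASSEMBLY CHECK `mkGenusFrame D hD hD4 hsq h7 N hN hNc hKL U : GenusFrame` — the kernel's certificate that the §B
  declarations fill EVERY field l.113–154 in its exact letter (parameters and `U` as arguments); axioms of `mkGenusFrame`: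
  `propext, Classical.choice, Quot.sound`.


WHAT THIS FILE DOES.  For a discriminant `D` (`D < 0`, `D ≡ 1 (mod 4)`, squarefree, `7 ∤ D`) it CONSTRUCTS / PROVES, one
declaration per field and in the EXACT letter of the field (`RamifiedSevenGenusFactorisationShape.lean` l.101–157), every
field of `GenusSeven.GenusFrame` between `v` (l.113) and `r_logTable` (l.154) — i.e. everything except the road data
`D, normA` (parameters) and the semi-local datum `U` (l.156–157, row K2C-13 ★).  Namespace
`Summit.BirchSwinnertonDyer.Rank1Residual.Additive.GenusSeven.ArithmeticInputs`.

FINDINGS (boxed for the pen; none is a letter deviation):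
  ┌ (F1) `hKL`.  `g`/`g_spec` are the only declarations under the named fact `iwasawa_existsUnique_kubotaLeopoldtSeries`
  │      (row card: «displayed hypothesis hKL»); `genusFrameOf … (hKL) …` must thread it.  Everything else is unconditional.
  │ (F2) `[NeZero D.natAbs]`.  `χD`, `zetaLevel/ζsys`, `etaOne/galToPow/η₁`, `g` carry the instance binder (Mathlib's
  │      `jacobiCharInt`/`DirichletCharacter` API wants it); at the frame constructor: `haveI := ⟨Int.natAbs_ne_zero.mpr hD.ne⟩`.
  │      The field `g_spec : ∀ [NeZero D.natAbs], …` is then `g_spec D hKL hD4 hsq h7` (instances of a `Prop`-class agree).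
  │ (F3) ℚ-ALGEBRA DIAMOND on `ℚ̄`.  A freshly elaborated `ℚ̄ ≃ₐ[ℚ] ℚ̄` / `IntermediateField ℚ ℚ̄` picks Mathlib's
  │      `DivisionRing.toRatAlgebra`, while `absoluteGaloisGroup.toAlgEquiv ℚ σ` lands at `AlgebraicClosure.instAlgebra ℚ`; the two
  │      are DEFINITIONALLY equal but not at `instances` transparency: pass between them with `exact`/`Eq.trans`, never `rw`
  │      (see `η₁_trivial`, χ_D-part).  No statement is affected.
  │ (F4) `MulChar.ofUnitHom (f ^ n) = MulChar.ofUnitHom f ^ n` (`ofUnitHom_pow`) is not in Mathlib; 3 lines here.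
  └ (F5) `u = 64`, `χ₇(σ₈) = 8`, `γ₀ = σ₈²` exactly as the row card; `σ₈` is CHOSEN (surjectivity of `χ₇` + prime-to-7
         splitting, `Classical.choose`), so `γ₀`, `u`, `r`, `g` are noncomputable but closed terms.

HONEST LABEL: infrastructure (definitions + kernel lemmas); it closes no item, registers no stub, proves no summit
statement; stmt-BirchSwinnertonDyer-19945 is OPEN; `X12.CMRamifiedSeven` is NOT proved; BSD is claimed for no curve.
No `sorry`, no `instance`, no `notation`/`macro`, no named fact introduced, no attribute removed.

References: [Lang1990] S. Lang, Cyclotomic Fields I and II, Ch. 10 §1 (PDF p. 167: `γ`, `⟨a⟩ = γ^{α(a)}`, `r(a)`);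
[Tsuji1999] T. Tsuji, Semi-local units modulo cyclotomic units, J. Number Theory 78 (1999), §3–§4; [Washington1997]
L. Washington, Introduction to Cyclotomic Fields, Ch. 3–4 (conductors; Gauss sums, Lemma 4.7–4.8), Ch. 14 (p. 321);
[IrelandRosen1990] K. Ireland, M. Rosen, A Classical Introduction to Modern Number Theory, Ch. 6 §3 (the sign of the
quadratic Gauss sum squared, `g² = (−1)^{(p−1)/2} p`) and Ch. 13 §3; [Kato2004Asterisque] K. Kato, Astérisque 295, §15.5.
-/

noncomputable section

open scoped NumberField
open PowerSeries IsDedekindDomain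
open Literature.NumberTheory.EllipticCurves
open Literature.NumberTheory.EllipticCurves.IwasawaAlgebra
open Literature.NumberTheory.IwasawaTheory
open Literature.NumberTheory.IwasawaTheory.StickelbergerSeries
open Literature.NumberTheory.ComplexMultiplication.EllipticUnits

namespace Summit.BirchSwinnertonDyer.Rank1Residual.Additive.GenusSeven.ArithmeticInputs

/-! ## §B The frame inputs at `(p, level) = (7, |D|)` — one declaration per `GenusFrame` field (l.113–154), same names -/

section Frame

open Field Literature.NumberTheory.GaloisRepresentations Literature.NumberTheory.QuadraticFields
open Summit.BirchSwinnertonDyer.Rank1Residual.Additive.GenusSeven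

variable (D : ℤ)

/-! ### `etaOne_isPrimitive` (l.141–142): `η₁ = χ_D·ω⁵` mod `7|D|` is primitive -/

/-- **Characters with coprime conductors multiply to a PRIMITIVE character** (re-proved here from Mathlib's
`conductor_mul_dvd_lcm_conductor`, `conductor_inv`, `conductor_changeLevel`; the same lemma is proved in
`Theorems/EisensteinPrimesMazurMCOnCellBTwistbackTwistLineCharacters.lean`, which an `Additive/` file does not import). [cite: Washington1997, Ch. 3 (conductor of a product of characters of coprime conductors)] -/
theorem isPrimitive_mul_of_coprime_levels {R : Type*} [CommMonoidWithZero R] {n₁ n₂ : ℕ} [NeZero n₁] [NeZero n₂]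
    {χ₁ : DirichletCharacter R n₁} {χ₂ : DirichletCharacter R n₂} (h₁ : χ₁.IsPrimitive) (h₂ : χ₂.IsPrimitive)
    (hcop : n₁.Coprime n₂) :
    (DirichletCharacter.changeLevel (dvd_mul_right n₁ n₂) χ₁ *
      DirichletCharacter.changeLevel (dvd_mul_left n₂ n₁) χ₂ : DirichletCharacter R (n₁ * n₂)).IsPrimitive := by
  set χ : DirichletCharacter R (n₁ * n₂) := DirichletCharacter.changeLevel (dvd_mul_right n₁ n₂) χ₁ with hχ
  set ψ : DirichletCharacter R (n₁ * n₂) := DirichletCharacter.changeLevel (dvd_mul_left n₂ n₁) χ₂ with hψ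
  have hχc : χ.conductor = n₁ := by rw [hχ, DirichletCharacter.conductor_changeLevel]; exact h₁
  have hψc : ψ.conductor = n₂ := by rw [hψ, DirichletCharacter.conductor_changeLevel]; exact h₂
  have h : χ.conductor.Coprime ψ.conductor := by rw [hχc, hψc]; exact hcop
  rw [DirichletCharacter.isPrimitive_def]
  apply Nat.dvd_antisymm (DirichletCharacter.conductor_dvd_level _)
  have hχd : χ.conductor ∣ (χ * ψ).conductor := by
    have h1 : χ = (χ * ψ) * ψ⁻¹ := by rw [mul_assoc, mul_inv_cancel, mul_one]
    have h2 := DirichletCharacter.conductor_mul_dvd_lcm_conductor (χ * ψ) ψ⁻¹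
    rw [← h1, DirichletCharacter.conductor_inv] at h2
    exact h.dvd_of_dvd_mul_right (h2.trans (Nat.lcm_dvd_mul _ _))
  have hψd : ψ.conductor ∣ (χ * ψ).conductor := by
    have h1 : ψ = (χ * ψ) * χ⁻¹ := by rw [mul_comm χ ψ, mul_assoc, mul_inv_cancel, mul_one]
    have h2 := DirichletCharacter.conductor_mul_dvd_lcm_conductor (χ * ψ) χ⁻¹
    rw [← h1, DirichletCharacter.conductor_inv] at h2
    exact h.symm.dvd_of_dvd_mul_right (h2.trans (Nat.lcm_dvd_mul _ _))
  have h3 := h.mul_dvd_of_dvd_of_dvd hχd hψd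
  rwa [hχc, hψc] at h3

/-- **`η₁ = χ_D·ω⁵` read mod `|D|·7` is primitive** — the letter of field `etaOne_isPrimitive` (l.141–142). [cite: Lang1990, Ch. 10 §2 (PDF p. 171, «cond θ = dp»)] [cite: Washington1997, Ch. 3] -/
theorem etaOne_isPrimitive [NeZero D.natAbs] (hD4 : D % 4 = 1) (hsq : Squarefree D) (h7 : ¬ (7 : ℤ) ∣ D) :
    (DirichletCharacter.changeLevel (Dvd.intro 7 rfl) (χD D) *
      (DirichletCharacter.changeLevel (Dvd.intro_left D.natAbs rfl) ω) ^ 5).IsPrimitive := by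
  haveI : NeZero (7 : ℕ) := ⟨by norm_num⟩
  have hcop : D.natAbs.Coprime 7 :=
    ((Nat.Prime.coprime_iff_not_dvd Nat.prime_seven).mpr fun h => h7 (Int.ofNat_dvd_left.mpr h)).symm
  rw [← map_pow]
  exact isPrimitive_mul_of_coprime_levels (χD_isPrimitive D hD4 hsq) isPrimitive_ω_pow_five hcop

/-! ### `g`, `g_spec` (l.148–150): the `ℤ₇`-coefficient Kubota–Leopoldt series of `η₁` (under `hKL`) -/

/-- Under `hKL`: a `ℤ₇`-coefficient Kubota–Leopoldt series for `(χ_D, i = 5, u)` exists (§A4 at `p = 7`). [cite: Tsuji1999, p. 6 and §4 Thm. 4.3] -/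
theorem exists_g [NeZero D.natAbs] (hKL : iwasawa_existsUnique_kubotaLeopoldtSeries) (hD4 : D % 4 = 1)
    (hsq : Squarefree D) (h7 : ¬ (7 : ℤ) ∣ D) :
    ∃ g : IwasawaAlgebra 7, IsKubotaLeopoldtSeries 7 ((χD D).ringHomComp (KubotaLeopoldt.intAlgebraMap 7)) 5
      (u : ℤ_[7]) (PowerSeries.map (KubotaLeopoldt.intAlgebraMap 7) g) := by
  have hcop : D.natAbs.Coprime 7 :=
    ((Nat.Prime.coprime_iff_not_dvd Nat.prime_seven).mpr fun h => h7 (Int.ofNat_dvd_left.mpr h)).symm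
  exact exists_int_kubotaLeopoldtSeries hKL (by norm_num) hcop (χD_isPrimitive D hD4 hsq) (by norm_num)
    (by omega) u_topGenerator

/-- **`g = g_{η₁} ∈ Λ = ℤ₇⟦T⟧`** — field `g` (l.148), chosen from `exists_g`. [cite: Tsuji1999, §4 Definition p. 12] -/
def g [NeZero D.natAbs] (hKL : iwasawa_existsUnique_kubotaLeopoldtSeries) (hD4 : D % 4 = 1) (hsq : Squarefree D)
    (h7 : ¬ (7 : ℤ) ∣ D) : IwasawaAlgebra 7 :=
  (exists_g D hKL hD4 hsq h7).choose

/-- The letter of field `g_spec` (l.149–150). [cite: Tsuji1999, §4 Thm. 4.3] -/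
theorem g_spec [NeZero D.natAbs] (hKL : iwasawa_existsUnique_kubotaLeopoldtSeries) (hD4 : D % 4 = 1)
    (hsq : Squarefree D) (h7 : ¬ (7 : ℤ) ∣ D) :
    IsKubotaLeopoldtSeries 7 ((χD D).ringHomComp (KubotaLeopoldt.intAlgebraMap 7)) 5 (u : ℤ_[7])
      (PowerSeries.map (KubotaLeopoldt.intAlgebraMap 7) (g D hKL hD4 hsq h7)) :=
  (exists_g D hKL hD4 hsq h7).choose_spec

/-! ### `r`, `r_logTable` (l.153–154): a `γ`-log table for `(u, ω)` (§A2 at `p = 7`) -/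

/-- A `γ`-log table exists for `(u, ω)`. [cite: Lang1990, Ch. 10 §1 (PDF p. 167)] -/
theorem exists_r : ∃ r : ℕ → ℕ → ℕ, IsLogTable 7 (u : ℤ_[7]) ω r :=
  exists_isLogTable (by norm_num) u_topGenerator ω_teichmuller

/-- **The `γ`-log table** — field `r` (l.153). [cite: Lang1990, Ch. 10 §1 (PDF p. 167)] -/
def r : ℕ → ℕ → ℕ := exists_r.choose

/-- The letter of field `r_logTable` (l.154). [cite: Lang1990, Ch. 10 §1 (PDF p. 167)] -/
theorem r_logTable : IsLogTable 7 (u : ℤ_[7]) ω r := exists_r.choose_spec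

/-! ### `η₁`, `η₁_trivial`, `η₁_reading` (l.143–147): the genus character of `Υ = Gal(ℚ̄/B_∞)` through `ζsys 0` -/

/-- **`η₁ = χ_D·ω⁵` as a Dirichlet character mod `|D|·7`** (the character inside field `etaOne_isPrimitive`).
[cite: Tsuji1999, §4 (p. 12, «χ = φω^i»)] [cite: Lang1990, Ch. 10 §2 (PDF p. 171)] -/
def etaOne [NeZero D.natAbs] : DirichletCharacter ℤ_[7] (D.natAbs * 7) :=
  DirichletCharacter.changeLevel (Dvd.intro 7 rfl) (χD D) *
    (DirichletCharacter.changeLevel (Dvd.intro_left D.natAbs rfl) ω) ^ 5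

/-- `η₁` on units: `η₁(b) = χ_D(b mod |D|)·ω(b mod 7)⁵`. [cite: Tsuji1999, §4 (p. 12)] -/
theorem etaOne_apply_coe [NeZero D.natAbs] (b : (ZMod (D.natAbs * 7))ˣ) :
    etaOne D (b : ZMod (D.natAbs * 7)) =
      χD D (((b : ZMod (D.natAbs * 7))).val : ZMod D.natAbs) * (ω (((b : ZMod (D.natAbs * 7))).val : ZMod 7)) ^ 5 := by
  haveI : NeZero (D.natAbs * 7) := ⟨mul_ne_zero (NeZero.ne _) (by norm_num)⟩
  rw [etaOne, MulChar.mul_apply, MulChar.pow_apply_coe, DirichletCharacter.changeLevel_eq_cast_of_dvd,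
    DirichletCharacter.changeLevel_eq_cast_of_dvd, ZMod.cast_eq_val, ZMod.cast_eq_val]

/-- **The action of `Γ_ℚ` on `μ_{|D|·7}` read through `ζsys D 0`**: `σ ↦ a_σ ∈ (ℤ/|D|·7)^×` with `σ(ζ₀) = ζ₀^{a_σ}`
(Mathlib `IsPrimitiveRoot.autToPow` along `absoluteGaloisGroup.toAlgEquiv`). [cite: Washington1997, Thm. 2.5] -/
def galToPow [NeZero D.natAbs] (h7 : ¬ (7 : ℤ) ∣ D) : absoluteGaloisGroup ℚ →* (ZMod (D.natAbs * 7))ˣ :=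
  haveI : NeZero (D.natAbs * 7) := ⟨mul_ne_zero (NeZero.ne _) (by norm_num)⟩
  ((isPrimitiveRoot_ζsys_zero D h7).autToPow ℚ).comp (absoluteGaloisGroup.toAlgEquiv ℚ).toMonoidHom

/-- Defining property of `galToPow`. [cite: Washington1997, Thm. 2.5] -/
theorem ζsys_zero_pow_galToPow [NeZero D.natAbs] (h7 : ¬ (7 : ℤ) ∣ D) (σ : absoluteGaloisGroup ℚ) :
    ζsys D 0 ^ ((galToPow D h7 σ : (ZMod (D.natAbs * 7))ˣ) : ZMod (D.natAbs * 7)).val =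
      absoluteGaloisGroup.toAlgEquiv ℚ σ (ζsys D 0) := by
  haveI : NeZero (D.natAbs * 7) := ⟨mul_ne_zero (NeZero.ne _) (by norm_num)⟩
  exact (isPrimitiveRoot_ζsys_zero D h7).autToPow_spec ℚ _

/-- If `σ(ζ₀) = ζ₀^a` then `a_σ = a` in `ℤ/|D|·7`. [cite: Washington1997, Thm. 2.5] -/
theorem galToPow_eq_natCast [NeZero D.natAbs] (h7 : ¬ (7 : ℤ) ∣ D) {σ : absoluteGaloisGroup ℚ} {a : ℕ}
    (ha : absoluteGaloisGroup.toAlgEquiv ℚ σ (ζsys D 0) = ζsys D 0 ^ a) :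
    ((galToPow D h7 σ : (ZMod (D.natAbs * 7))ˣ) : ZMod (D.natAbs * 7)) = (a : ZMod (D.natAbs * 7)) := by
  haveI : NeZero (D.natAbs * 7) := ⟨mul_ne_zero (NeZero.ne _) (by norm_num)⟩
  have hζ := isPrimitiveRoot_ζsys_zero D h7
  have hpos : 0 < D.natAbs * 7 := Nat.pos_of_ne_zero (NeZero.ne _)
  have h1 : ζsys D 0 ^ ((galToPow D h7 σ : (ZMod (D.natAbs * 7))ˣ) : ZMod (D.natAbs * 7)).val =
      ζsys D 0 ^ (a % (D.natAbs * 7)) := by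
    rw [ζsys_zero_pow_galToPow, ha]
    exact pow_eq_pow_mod a hζ.pow_eq_one
  have h2 := hζ.pow_inj (ZMod.val_lt _) (Nat.mod_lt a hpos) h1
  rw [← ZMod.natCast_zmod_val ((galToPow D h7 σ : (ZMod (D.natAbs * 7))ˣ) : ZMod (D.natAbs * 7)), h2,
    ZMod.natCast_mod]

/-- **The genus character `η₁ : Υ → ℤ₇^×`**, `η₁(σ) = (χ_D ω⁵)(a_σ)` — field `η₁` (l.143). [cite: Tsuji1999, §3 (p. 6) and §4 (p. 12)] -/
def η₁ [NeZero D.natAbs] (h7 : ¬ (7 : ℤ) ∣ D) : torsionCyclotomicSubgroup 7 →* ℤ_[7]ˣ :=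
  ((MulChar.toUnitHom (etaOne D)).comp (galToPow D h7)).comp (torsionCyclotomicSubgroup 7).subtype

/-- Unfolding `η₁`. [cite: Tsuji1999, §4 (p. 12)] -/
theorem coe_η₁_apply [NeZero D.natAbs] (h7 : ¬ (7 : ℤ) ∣ D) (σ : torsionCyclotomicSubgroup 7) :
    ((η₁ D h7 σ : ℤ_[7]ˣ) : ℤ_[7]) =
      etaOne D ((galToPow D h7 (σ : absoluteGaloisGroup ℚ) : (ZMod (D.natAbs * 7))ˣ) : ZMod (D.natAbs * 7)) :=
  rfl

/-- **`η₁` READS AS `χ_D·ω⁵` through `ζsys 0`** — the letter of field `η₁_reading` (l.147). [cite: Tsuji1999, §4 (p. 12, L14–19) and §5 (p. 14, L30–33)] -/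
theorem η₁_reading [NeZero D.natAbs] (h7 : ¬ (7 : ℤ) ∣ D) :
    IsDirichletReading 7 (torsionCyclotomicSubgroup 7) (η₁ D h7) (ζsys D 0) (χD D) ω 5 := by
  intro σ a ha
  haveI : NeZero (D.natAbs * 7) := ⟨mul_ne_zero (NeZero.ne _) (by norm_num)⟩
  have hg : ((galToPow D h7 (σ : absoluteGaloisGroup ℚ) : (ZMod (D.natAbs * 7))ˣ) : ZMod (D.natAbs * 7)).val =
      a % (D.natAbs * 7) := by
    rw [galToPow_eq_natCast D h7 ha, ZMod.val_natCast]
  have hD' : ((a % (D.natAbs * 7) : ℕ) : ZMod D.natAbs) = (a : ZMod D.natAbs) := by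
    rw [ZMod.natCast_eq_natCast_iff', Nat.mod_mul_right_mod]
  have h7' : ((a % (D.natAbs * 7) : ℕ) : ZMod 7) = (a : ZMod 7) := by
    rw [ZMod.natCast_eq_natCast_iff', Nat.mod_mul_left_mod]
  rw [coe_η₁_apply, etaOne_apply_coe, hg, hD', h7']

/-- **`η₁` IS TRIVIAL ON `Gal(ℚ̄/K_∞)`** — the letter of field `η₁_trivial` (l.144–145): an element of `Υ` fixing
`K_0 = F₀(μ₇)` fixes `μ₇` (so `a_σ ≡ 1 (mod 7)`, `ω⁵(a_σ) = 1`) and fixes the Gauss square root `G = √D ∈ F₀`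
(§A5: `σ G = (a_σ | |D|)·G`, `G ≠ 0`, so `χ_D(a_σ) = (a_σ | |D|) = 1`). [cite: Tsuji1999, §3 (p. 6, L1–5)] [cite: Washington1997, Ch. 4 Lemma 4.8] -/
theorem η₁_trivial [NeZero D.natAbs] (hD : D < 0) (hD4 : D % 4 = 1) (hsq : Squarefree D) (h7 : ¬ (7 : ℤ) ∣ D) :
    ∀ σ : torsionCyclotomicSubgroup 7,
      (∀ n, (σ : absoluteGaloisGroup ℚ) ∈ fixingSubgroupQ (cyclotomicLayer (F₀ D) 7 n)) → η₁ D h7 σ = 1 := by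
  intro σ hσ
  haveI : NeZero (7 : ℕ) := ⟨by norm_num⟩
  haveI : NeZero (D.natAbs * 7) := ⟨mul_ne_zero (NeZero.ne _) (by norm_num)⟩
  have hodd : Odd D.natAbs := by rw [Int.natAbs_odd]; exact Int.odd_iff.mpr (by omega)
  have hsq' : Squarefree D.natAbs := Int.squarefree_natAbs.mpr hsq
  have h3 : D.natAbs % 4 = 3 := by omega
  have hpos : 0 < D.natAbs * 7 := Nat.pos_of_ne_zero (NeZero.ne _)
  have hfix := (mem_fixingSubgroupQ_iff _ _).mp (hσ 0)
  have hζ := isPrimitiveRoot_ζsys_zero D h7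
  -- the exponent `b = a_σ`
  obtain ⟨b, hb⟩ : ∃ b : ℕ,
      ((galToPow D h7 (σ : absoluteGaloisGroup ℚ) : (ZMod (D.natAbs * 7))ˣ) : ZMod (D.natAbs * 7)).val = b :=
    ⟨_, rfl⟩
  have hσζ : (σ : absoluteGaloisGroup ℚ) • ζsys D 0 = ζsys D 0 ^ b := by
    rw [absoluteGaloisGroup.smul_def, ← ζsys_zero_pow_galToPow D h7, hb]
  have hpow : ∀ k : ℕ, k ∣ D.natAbs * 7 → ∀ ζ : AlgebraicClosure ℚ, ζ ^ k = 1 →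
      (σ : absoluteGaloisGroup ℚ) • ζ = ζ ^ b :=
    fun k hk ζ hζk => GenusFrame.smul_eq_pow_of_smul_primitiveRoot hζ hσζ hk ζ hζk
  -- (ω-part) `σ` fixes `μ₇ ⊆ K_0`, so `b ≡ 1 (mod 7)`
  have h7part : (b : ZMod 7) = 1 := by
    have hζ7 : IsPrimitiveRoot (ζsys D 0 ^ D.natAbs) 7 := IsPrimitiveRoot.pow hpos hζ rfl
    have hmem : ζsys D 0 ^ D.natAbs ∈ cyclotomicLayer (F₀ D) 7 0 :=
      mem_cyclotomicLayer_of_pow_eq_one (F₀ D) 7 0 (by rw [zero_add, pow_one]; exact hζ7.pow_eq_one)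
    have hfix7 : (σ : absoluteGaloisGroup ℚ) • (ζsys D 0 ^ D.natAbs) = ζsys D 0 ^ D.natAbs := by
      rw [absoluteGaloisGroup.smul_def]; exact hfix _ hmem
    have hb7 : (ζsys D 0 ^ D.natAbs) ^ (b % 7) = (ζsys D 0 ^ D.natAbs) ^ (1 % 7) := by
      rw [← pow_eq_pow_mod b hζ7.pow_eq_one, ← pow_eq_pow_mod 1 hζ7.pow_eq_one, pow_one,
        ← hpow 7 (dvd_mul_left 7 _) _ hζ7.pow_eq_one, hfix7]
    have hmod := hζ7.pow_inj (Nat.mod_lt b (by norm_num)) (Nat.mod_lt 1 (by norm_num)) hb7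
    have := (ZMod.natCast_eq_natCast_iff' b 1 7).mpr hmod
    rwa [Nat.cast_one] at this
  -- (χ_D-part) `σ` fixes the Gauss square root `G = √D ∈ F₀ ≤ K_0`, so `(b | |D|) = 1`
  have hDpart : χD D (b : ZMod D.natAbs) = 1 := by
    obtain ⟨G, -, hGsq, hG0, hGal⟩ := exists_gaussSqrt hodd hsq'
    have hcast : ((D.natAbs : ℕ) : AlgebraicClosure ℚ) = -(D : AlgebraicClosure ℚ) := by
      have : ((D.natAbs : ℕ) : ℤ) = -D := by omega
      rw [← Int.cast_natCast, this, Int.cast_neg]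
    have hG2 : G ^ 2 = (D : AlgebraicClosure ℚ) := by
      rw [hGsq, ZMod.χ₄_nat_three_mod_four h3, hcast]; push_cast; ring
    have hGF : G ∈ F₀ D := IntermediateField.subset_adjoin ℚ _ (by exact hG2)
    have hσG : absoluteGaloisGroup.toAlgEquiv ℚ (σ : absoluteGaloisGroup ℚ) G = G :=
      hfix G (le_cyclotomicLayer (F₀ D) 7 0 hGF)
    -- (`hGal` quantifies over `ℚ̄ ≃ₐ[ℚ] ℚ̄` at Mathlib's `DivisionRing.toRatAlgebra`; `toAlgEquiv` lands at
    -- `AlgebraicClosure.instAlgebra` — the two agree definitionally, so we pass between them by `exact`, not `rw`)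
    have hGal' := hGal (absoluteGaloisGroup.toAlgEquiv ℚ (σ : absoluteGaloisGroup ℚ)) b fun ζ hζD => by
      have h := hpow D.natAbs (dvd_mul_right _ _) ζ hζD
      rw [absoluteGaloisGroup.smul_def] at h
      exact h
    have hJG : (jacobiSym b D.natAbs : AlgebraicClosure ℚ) * G = 1 * G := by
      rw [one_mul]; exact hGal'.symm.trans hσG
    have hJ : (jacobiSym b D.natAbs : AlgebraicClosure ℚ) = 1 := mul_right_cancel₀ hG0 hJG
    have hJ1 : jacobiSym b D.natAbs = 1 := by
      rcases jacobiSym.trichotomy b D.natAbs with h | h | h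
      · rw [h, Int.cast_zero] at hJ; exact absurd hJ zero_ne_one
      · exact h
      · rw [h, Int.cast_neg, Int.cast_one] at hJ; norm_num at hJ
    rw [χD_apply, jacobiCharInt_natCast, hJ1, Int.cast_one]
  -- assemble
  ext
  rw [Units.val_one, coe_η₁_apply, etaOne_apply_coe, hb, hDpart, h7part, map_one, one_pow, mul_one]

/-! ### Assembly check (letter discipline, mechanical) -/

/-- **ASSEMBLY CHECK — the §B declarations populate EVERY field of `GenusSeven.GenusFrame` in its exact letter**, except
the road parameters (`D` with its four hypotheses, `normA` with its two) and the semi-local datum `U` (row K2C-13 ★),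
which are taken as ARGUMENTS; `hKL` is the displayed named fact (for `g`).  This is NOT `genusFrameOf` of the later file
(6) (that one will also PRODUCE `U` and `normA`); it is the kernel's certificate that nothing in l.113–154 is left open.
[cite: Tsuji1999, §3 Thm 3.1 (p. 6) — the binders] [cite: Kato2004Asterisque, §15.5 (p. 253)] -/
def mkGenusFrame (hD : D < 0) (hD4 : D % 4 = 1) (hsq : Squarefree D) (h7 : ¬ (7 : ℤ) ∣ D) (N : ℕ) (hN : 2 ≤ N)
    (hNc : N.Coprime (7 * D.natAbs)) (hKL : iwasawa_existsUnique_kubotaLeopoldtSeries)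
    (U : CyclotomicSemilocalUnitData 7 placeSeven (cyclotomicLayer (F₀ D) 7) (cyclotomicLayer_monotone (F₀ D) 7)
      (torsionCyclotomicSubgroup 7) γ₀) : GenusFrame :=
  haveI : NeZero D.natAbs := ⟨Int.natAbs_ne_zero.mpr hD.ne⟩
  { D := D, D_neg := hD, D_mod_four := hD4, D_squarefree := hsq, not_seven_dvd_D := h7, normA := N, two_le_normA := hN,
    normA_coprime := hNc, v := placeSeven, seven_mem_v := seven_mem_placeSeven, F₀ := F₀ D, F₀_eq := F₀_eq D,
    F₀_le := F₀_le D hD hD4 hsq, ζsys := ζsys D, ζsys_compatible := ζsys_compatible D h7, u := u,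
    u_topGenerator := u_topGenerator, γ₀ := γ₀, cyclotomicCharacter_γ₀ := cyclotomicCharacter_γ₀,
    γ₀_mem := γ₀_mem D hD hD4 hsq h7, χD := χD D, χD_isPrimitive := χD_isPrimitive D hD4 hsq, χD_mul_self := χD_mul_self D,
    χD_neg_one := χD_neg_one D hD hD4, ω := ω, ω_teichmuller := ω_teichmuller,
    etaOne_isPrimitive := etaOne_isPrimitive D hD4 hsq h7, η₁ := η₁ D h7, η₁_trivial := η₁_trivial D hD hD4 hsq h7,
    η₁_reading := η₁_reading D h7, g := g D hKL hD4 hsq h7, g_spec := g_spec D hKL hD4 hsq h7, r := r,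
    r_logTable := r_logTable, U := U }

/-- The assembled frame has the given discriminant. [cite: Tsuji1999, §3 (p. 5)] -/
theorem mkGenusFrame_D (hD : D < 0) (hD4 : D % 4 = 1) (hsq : Squarefree D) (h7 : ¬ (7 : ℤ) ∣ D) (N : ℕ) (hN : 2 ≤ N)
    (hNc : N.Coprime (7 * D.natAbs)) (hKL : iwasawa_existsUnique_kubotaLeopoldtSeries)
    (U : CyclotomicSemilocalUnitData 7 placeSeven (cyclotomicLayer (F₀ D) 7) (cyclotomicLayer_monotone (F₀ D) 7)
      (torsionCyclotomicSubgroup 7) γ₀) :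
    (mkGenusFrame D hD hD4 hsq h7 N hN hNc hKL U).D = D := rfl

end Frame

end Summit.BirchSwinnertonDyer.Rank1Residual.Additive.GenusSeven.ArithmeticInputs

end
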